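import Summits.BirchSwinnertonDyer.BirchSwinnertonDyer.Theorems.PrintCf2SplitBadTwoRestrictedSelmerLocalTrivialAwayFromP
import Summits.BirchSwinnertonDyer.BirchSwinnertonDyer.Theorems.PrintCf2SplitBadTwoRestrictedSelmerArchimedeanLocalKer
import HarnessLib

/-!
# Crux `PrintCf2.SplitBadTwoRankOneOfFacts` (stmt-BirchSwinnertonDyer-20368), road α, stub S3c — hypothesis (H1) of the bottom value reduced to
# its CM core: on a totally complex base, the Kummer classes of the summand lie in `𝔖_v(K, E[𝔮^∞])` as soon as they are STRICT AT `v`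

Cell `bsd-print-cf2`, width seat `bsd-line-cf2-p1-w7` g2, file 6 of the bottom-value lane (p661732, p662108, p662922, p663238, `…LocalTrivialAwayFromP`);
`--supports stmt-BirchSwinnertonDyer-20368` (helper, Theses-free). HONEST FRAMING: nothing here closes a crux or a stub; BSD is not proved by any of
this; no summit statement is proved by this seat. No definition, no named fact, no `sorry`, no kit. beyond-print theorem: no.

WHAT. `natCard_restrictedSelmerBase_eq_three_mul_summand` (p663238) displays (H1) `Q_M ≤ 𝔖_v(K, M)` for the canonical Kummer subgroup
`Q_M = ι_*⁻¹(res_⊤(range κ))` of the summand `M = E[𝔮^∞]`. Agboola's `𝔖_v(K, M)` is three conditions (`mem_restrictedSelmerBase_iff_resOfLe`,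
-w7 g0 p649193): locally zero at every finite `w ∤ p` — DISCHARGED for `Q_M` by `comap_kummer_le_ker_resOfLe_of_not_mem`
(`…LocalTrivialAwayFromP`, Greenberg Prop. 2.1); locally zero at every infinite place — AUTOMATIC on a totally complex base (`D_w = 1`,
LEAD g11 p658763 `subgroupH1_eq_zero_of_le_bot` + `BigGaloisRep.decompInf_eq_bot_of_isComplex`); and locally zero at `v` — the CM INPUT
(«`E(K_𝔭) ⊗ D_{𝔭*} = 0`»: the `E[𝔮^∞]`-component of a Kummer class dies at the place where `E[𝔮^∞]` is the étale summand). Hence: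
* `resOfLe_decompInf_eq_zero_of_isComplex` / `…_of_isImaginaryQuadratic` — every class of `H¹(K, M)` is locally zero at a complex place;
* **`le_restrictedSelmerBase_of_forall_not_mem_of_strict`** (generic `M`, totally complex `K`): a subgroup locally zero at all finite `w ∤ p` and at
  `v` lies in `𝔖_v(K, M)`;
* **`comap_kummer_le_restrictedSelmerBase_of_strict`** — (H1) ⟸ (H1′) `Q_M ≤ ker loc_v` for the CM summand with complementary conjugate summand
  over an imaginary quadratic `K` (every S3c frame field);
* **`natCard_restrictedSelmerBase_eq_three_mul_summand_of_strict`** / `padicValNat_…` — the bottom value of `𝔖_{v̄}(K, E[𝔮^∞])` as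
  `#(Q_M ⊓ ker loc_{v̄}) · #((𝔖_v ⊓ L_M) ⧸ Q_M) · #loc_v(𝔖_{v̄})` GRANTED ONLY (H1′) strictness at `v` of the summand's Kummer classes and (H2)
  `r = 1` exhaustion at `v̄` — both statements about `E(K_v) = E(ℚ₂)`-points of the member and its `ℚ`-generator (bricks B7 / T4).

References: A. Agboola, Compositio 143 (2007) §3, §6 Props. 6.10–6.11 [Agboola2007]; R. Greenberg, LNM 1716 (1999) §2 Prop. 2.1, §3 p. 87
[GreenbergLNM1716].
-/

noncomputable section

open scoped Classical

set_option linter.dupNamespace false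
set_option autoImplicit false

open NumberField IsDedekindDomain Field
open Literature.NumberTheory.EllipticCurves Literature.NumberTheory.EllipticCurves.GreenbergSelmer
open Literature.NumberTheory.EllipticCurves.Castella2018.AcSelmer
open Literature.NumberTheory.EllipticCurves.Agboola2007
open Literature.NumberTheory.EllipticCurves.ResKernel
open Literature.NumberTheory.GaloisRepresentations

universe u

namespace Summit.BirchSwinnertonDyer.BirchSwinnertonDyer.Theorems.PrintCf2.RestrictedSelmerPair

/-! ## §1. Complex places impose nothing; the generic membership criterion -/

section Generic

variable {K : Type u} [Field K] [NumberField K] (M : Type u) [AddCommGroup M]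
  [DistribMulAction (absoluteGaloisGroup K) M] [TopologicalSpace M] [DiscreteTopology M]
  (p : ℕ) (v : HeightOneSpectrum (𝓞 K))

omit [NumberField K] in
/-- **At a complex place every class is locally zero** (`D_w = 1`). [cite: GreenbergLNM1716, §3 p. 87 (archimedean primes split completely)] -/
theorem resOfLe_decompInf_eq_zero_of_isComplex {w : InfinitePlace K} (hw : w.IsComplex)
    (c : subgroupH1 (⊤ : Subgroup (absoluteGaloisGroup K)) M) :
    resOfLe M (inf_le_left : ⊤ ⊓ decompInf w ≤ ⊤) c = 0 := by
  have hle : (⊤ : Subgroup (absoluteGaloisGroup K)) ⊓ decompInf w ≤ ⊥ := by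
    rw [BigGaloisRep.decompInf_eq_bot_of_isComplex hw, inf_bot_eq]
  exact subgroupH1_eq_zero_of_le_bot M hle _

/-- **On an imaginary quadratic base every class is locally zero at the (unique, complex) infinite place.**
[cite: GreenbergLNM1716, §3 p. 87] -/
theorem resOfLe_decompInf_eq_zero_of_isImaginaryQuadratic (hK : IsImaginaryQuadratic K) (w : InfinitePlace K)
    (c : subgroupH1 (⊤ : Subgroup (absoluteGaloisGroup K)) M) :
    resOfLe M (inf_le_left : ⊤ ⊓ decompInf w ≤ ⊤) c = 0 :=
  resOfLe_decompInf_eq_zero_of_isComplex M (hK.2.isComplex w) c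

/-- **Membership in `𝔖_v(K, M)` on a totally complex base**: a subgroup of `H¹(K, M)` which is locally zero at every finite `w ∤ p` and at `v`
lies in Agboola's `𝔖_v(K, M)` (the infinite places impose nothing). [cite: Agboola2007, §3 (arXiv p0008:L58–64), §6] -/
theorem le_restrictedSelmerBase_of_forall_not_mem_of_strict (hK : ∀ w : InfinitePlace K, w.IsComplex)
    (Q : AddSubgroup (subgroupH1 (⊤ : Subgroup (absoluteGaloisGroup K)) M))
    (haway : ∀ w : HeightOneSpectrum (𝓞 K), ((p : ℕ) : 𝓞 K) ∉ w.asIdeal →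
      Q ≤ (resOfLe M (inf_le_left : ⊤ ⊓ decomp w ≤ ⊤)).ker)
    (hstrict : Q ≤ (resOfLe M (inf_le_left : ⊤ ⊓ decomp v ≤ ⊤)).ker) :
    Q ≤ restrictedSelmerBase M p v := by
  intro c hc
  rw [mem_restrictedSelmerBase_iff_resOfLe]
  exact ⟨fun w hw ↦ AddMonoidHom.mem_ker.mp (haway w hw hc), fun w ↦ resOfLe_decompInf_eq_zero_of_isComplex M (hK w) c,
    AddMonoidHom.mem_ker.mp (hstrict hc)⟩

end Generic

/-! ## §2. The CM summand over an imaginary quadratic base: (H1) ⟸ strictness at `v` -/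

section Summand

variable {K : Type u} [Field K] [NumberField K] (V : WeierstrassCurve K) [V.IsElliptic] (p : ℕ) [Fact p.Prime]
  (π : V.endRing) (r r' : ℤ_[p]) (v vbar : HeightOneSpectrum (𝓞 K))

/-- **(H1) ⟸ (H1′) on an imaginary quadratic base.** For `M = E[𝔮^∞]` with complementary conjugate summand, the canonical Kummer subgroup
`Q_M = ι_*⁻¹(res_⊤(range κ))` lies in `𝔖_v(K, M)` as soon as it is STRICT AT `v` (`Q_M ≤ ker loc_v` — the CM input: the `E[𝔮^∞]`-component of
a Kummer class dies at the place `v` where `E[𝔮^∞]` is the étale summand); the conditions away from `p` hold by `…LocalTrivialAwayFromP` and at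
infinity there is nothing to check. [cite: Agboola2007, §3, §6 («E(K_𝔭*) ⊗ D_𝔭 = 0», arXiv p0014:L5)] [cite: GreenbergLNM1716, §2 Prop. 2.1] -/
theorem comap_kummer_le_restrictedSelmerBase_of_strict (hK : IsImaginaryQuadratic K)
    (hinf : V.endEigenPrimaryTorsion p π r ⊓ V.endEigenPrimaryTorsion p π r' = ⊥)
    (hsup : V.endEigenPrimaryTorsion p π r ⊔ V.endEigenPrimaryTorsion p π r' = ⊤)
    (hstrict : (((V.kummerMapPInfty p V.zsmul_geomPoints_surjective_holds).range).map
          (resSubgroup ⊤ (V.geomPrimaryTorsion p))).comap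
        (resH1Hom (ContinuousMonoidHom.id _) (V.endEigenPrimaryTorsion p π r).subtype (fun _ _ ↦ rfl)) ≤
      (resOfLe ↥(V.endEigenPrimaryTorsion p π r) (inf_le_left : ⊤ ⊓ decomp v ≤ ⊤)).ker) :
    (((V.kummerMapPInfty p V.zsmul_geomPoints_surjective_holds).range).map
          (resSubgroup ⊤ (V.geomPrimaryTorsion p))).comap
        (resH1Hom (ContinuousMonoidHom.id _) (V.endEigenPrimaryTorsion p π r).subtype (fun _ _ ↦ rfl)) ≤
      restrictedSelmerBase ↥(V.endEigenPrimaryTorsion p π r) p v :=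
  le_restrictedSelmerBase_of_forall_not_mem_of_strict _ p v (fun w ↦ hK.2.isComplex w) _
    (fun w hw ↦ comap_kummer_le_ker_resOfLe_of_not_mem V p π r r' hinf hsup w hw) hstrict

/-- **THE BOTTOM VALUE OF `𝔖_{v̄}(K, E[𝔮^∞])` ON AN IMAGINARY QUADRATIC BASE, modulo the two `E(K_v)`/`E(K_{v̄})`-statements only.**
With `M = E[𝔮^∞]` (complementary conjugate summand), `Q_M = ι_*⁻¹(res_⊤(range κ))`, `L_M = ι_*⁻¹(localKerOver p ⊤ K_{v̄})`:
GRANTED (H1′) `Q_M ≤ ker loc_v` (strict at `v`) and (H2) `loc_{v̄}(𝔖_v ⊓ L_M) ⊆ loc_{v̄}(Q_M)` (`r = 1` exhaustion),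
`#𝔖_{v̄}(K, M) = #(Q_M ⊓ ker loc_{v̄}) · #((𝔖_v(K, M) ⊓ L_M) ⧸ Q_M) · #loc_v(𝔖_{v̄}(K, M))`.
[cite: Agboola2007, Props. 6.10, 6.11 (arXiv p0014:L1–p0015:L12)] -/
theorem natCard_restrictedSelmerBase_eq_three_mul_summand_of_strict (hK : IsImaginaryQuadratic K)
    (hinf : V.endEigenPrimaryTorsion p π r ⊓ V.endEigenPrimaryTorsion p π r' = ⊥)
    (hsup : V.endEigenPrimaryTorsion p π r ⊔ V.endEigenPrimaryTorsion p π r' = ⊤)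
    (hstrict : (((V.kummerMapPInfty p V.zsmul_geomPoints_surjective_holds).range).map
          (resSubgroup ⊤ (V.geomPrimaryTorsion p))).comap
        (resH1Hom (ContinuousMonoidHom.id _) (V.endEigenPrimaryTorsion p π r).subtype (fun _ _ ↦ rfl)) ≤
      (resOfLe ↥(V.endEigenPrimaryTorsion p π r) (inf_le_left : ⊤ ⊓ decomp v ≤ ⊤)).ker)
    (hcov : (restrictedSelmerBase ↥(V.endEigenPrimaryTorsion p π r) p v ⊓
          (V.localKerOver p ⊤ (vbar.adicCompletion K)).comap
            (resH1Hom (ContinuousMonoidHom.id _) (V.endEigenPrimaryTorsion p π r).subtype (fun _ _ ↦ rfl))).map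
          (resOfLe ↥(V.endEigenPrimaryTorsion p π r) (inf_le_left : ⊤ ⊓ decomp vbar ≤ ⊤)) ≤
      ((((V.kummerMapPInfty p V.zsmul_geomPoints_surjective_holds).range).map
          (resSubgroup ⊤ (V.geomPrimaryTorsion p))).comap
        (resH1Hom (ContinuousMonoidHom.id _) (V.endEigenPrimaryTorsion p π r).subtype (fun _ _ ↦ rfl))).map
          (resOfLe ↥(V.endEigenPrimaryTorsion p π r) (inf_le_left : ⊤ ⊓ decomp vbar ≤ ⊤))) :
    Nat.card (restrictedSelmerBase ↥(V.endEigenPrimaryTorsion p π r) p vbar) =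
      Nat.card ↥((((V.kummerMapPInfty p V.zsmul_geomPoints_surjective_holds).range).map
            (resSubgroup ⊤ (V.geomPrimaryTorsion p))).comap
          (resH1Hom (ContinuousMonoidHom.id _) (V.endEigenPrimaryTorsion p π r).subtype (fun _ _ ↦ rfl)) ⊓
          (resOfLe ↥(V.endEigenPrimaryTorsion p π r) (inf_le_left : ⊤ ⊓ decomp vbar ≤ ⊤)).ker) *
        Nat.card (↥(restrictedSelmerBase ↥(V.endEigenPrimaryTorsion p π r) p v ⊓
            (V.localKerOver p ⊤ (vbar.adicCompletion K)).comap
              (resH1Hom (ContinuousMonoidHom.id _) (V.endEigenPrimaryTorsion p π r).subtype (fun _ _ ↦ rfl))) ⧸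
          ((((V.kummerMapPInfty p V.zsmul_geomPoints_surjective_holds).range).map
              (resSubgroup ⊤ (V.geomPrimaryTorsion p))).comap
            (resH1Hom (ContinuousMonoidHom.id _) (V.endEigenPrimaryTorsion p π r).subtype (fun _ _ ↦ rfl))).addSubgroupOf
            (restrictedSelmerBase ↥(V.endEigenPrimaryTorsion p π r) p v ⊓
              (V.localKerOver p ⊤ (vbar.adicCompletion K)).comap
                (resH1Hom (ContinuousMonoidHom.id _) (V.endEigenPrimaryTorsion p π r).subtype (fun _ _ ↦ rfl)))) *
        Nat.card ((resOfLe ↥(V.endEigenPrimaryTorsion p π r) (inf_le_left : ⊤ ⊓ decomp v ≤ ⊤)).comp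
          (restrictedSelmerBase ↥(V.endEigenPrimaryTorsion p π r) p vbar).subtype).range :=
  natCard_restrictedSelmerBase_eq_three_mul_summand V p π r v vbar
    (comap_kummer_le_restrictedSelmerBase_of_strict V p π r r' v hK hinf hsup hstrict) hcov

end Summand

end Summit.BirchSwinnertonDyer.BirchSwinnertonDyer.Theorems.PrintCf2.RestrictedSelmerPair

end
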